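import Literature.NumberTheory.Automorphic.SatakeTransformGLInjective
import Literature.NumberTheory.Automorphic.CartanDecompositionGLnUnique
import HarnessLib

/-!
# Iwasawa versus Cartan for `GL_n`, the uniqueness half: `GL_n(𝒪) ϖ^a GL_n(𝒪) ∩ N ϖ^a GL_n(𝒪) = ϖ^a GL_n(𝒪)`
# (Bruhat–Tits 1972, Prop. (4.4.4) (ii)), and injectivity of the Satake transform over EVERY coefficient ring

Topic `NumberTheory/Automorphic`; namespaces `Literature.NumberTheory.Automorphic` and `….IsIwasawaExponent` (lane
`lit-hodgefound`, Track 2 foundations; seat `lit-hodgefound-p11`, generation 42, row g42-#1).  THEOREMS ONLY: no definition,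
no named fact, no instance, no notation.  Sequel of `CartanIwasawaDominanceGL` (Bruhat–Tits (4.4.4) (i) for `GL_n`: the
Iwasawa exponents of the cosets in `K ϖ^a K` are dominated by `a`) and of `SatakeTransformIwasawaInjective` /
`SatakeTransformGLInjective` (injectivity of the Satake transform from (CARTAN) + (SEPARATION) + (DOMINANCE), which there needs a
coefficient DOMAIN OF CHARACTERISTIC `0` because the leading coefficient of `𝒮_w(T_t)` is `#{γ ⊆ KtK : a(γ) = a(t)} · w(a(t))`
and only `#{…} ≥ 1` — Bruhat–Tits (4.4.4) (ii) «`⊇`» — was available).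

## The print

[BruhatTits1972] Prop. (4.4.4) (p. 80): «Soit `K` un bon sous-groupe borné maximal de `G` contenant `B̂` et soient `t ∈ V_D`,
`t' ∈ V`, `t'' ∈ V_D`.  (i) Si `K.t.K ∩ B̂⁰.t'.K ≠ ∅`, on a `t' ≤ t` […].  (ii) On a `K.t.K ∩ B̂⁰.t.K = t.K`.»  For
`G = GL_n(F)`, `K = GL_n(𝒪)`, `B̂⁰ ⊇ N` the upper unitriangular matrices and the torus lattice `{ϖ^a : a ∈ ℤⁿ}`, the cone
`V_D` of (ii) consists of the `ϖ^a` with `a` MONOTONE (`a_1 ≤ ⋯ ≤ a_n`, antidominant for the upper Borel: for `n = 2`,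
`K diag(ϖ,1) K ∩ N diag(ϖ,1) K` consists of the `q` cosets `(ϖ x; 0 1)K`, `x ∈ 𝒪/ϖ`, while
`K diag(1,ϖ) K ∩ N diag(1,ϖ) K = diag(1,ϖ) K`).  [Macdonald1995] Ch. V (2.3) «the `c_λ` form a `ℤ`-basis of `H(G, K)`»,
(2.6)–(2.7) (triangularity of the `c_λ` against the torus characters, proved by minors, Ch. II §1); [CartierCorvallis1979]
§IV Thm. 4.1, proof (b)–(c) «`c(λ, λ) ≠ 0` [in fact `= δ(λ)^{1/2}`] and `c(λ, μ) = 0` unless `μ ≤ λ` … hence the `Sc_λ` are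
linearly independent» — with (ii) the leading coefficient is EXACTLY the unit `w(a(t))`, so the argument runs over any
commutative coefficient ring.

Proof of (ii) for `GL_n` (by minors, as (i)): let `gK ⊆ K ϖ^a K` with Iwasawa exponent `e(g) = a`, `a` monotone; write
`g = u ϖ^a k` and `v = ϖ^{-a} u ϖ^a ∈ N(F)`, so that `u ϖ^a = ϖ^a v = g k⁻¹ ∈ K ϖ^a K · K`.  Every `(i+1) × (i+1)` minor
of `ϖ^a v` has valuation `≤ |ϖ|^{a_0 + ⋯ + a_i}` (the `i+1` smallest exponents; `zpowDiagGL_mem_minorBounded` of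
`CartanIwasawaDominanceGL` after conjugating `ϖ^a` to its antitone rearrangement by a permutation matrix), and the minor
with rows `0, …, i` and columns `0, …, i-1, j` (`i < j`) equals `ϖ^{a_0 + ⋯ + a_i} · v_{ij}`; hence `v_{ij} ∈ 𝒪`, `v ∈ K`
and `gK = ϖ^a K`.

## What is formalised

* §1 (`F` with a `ValuativeRel`, `𝒪[F]` a DVR, `ϖ` uniformizing) minors: `det_submatrix_first_of_blockTriangular`,
  `sum_first_eq_sum_ite`, `sum_ite_le_comp_rev_eq_sum_ite_lt`, `det_submatrix_castSucc_of_upperUnitriangular` (the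
  `(i+1) × (i+1)` minor of an upper unitriangular matrix with rows `0..i`, columns `0..i-1, j` is its `(i, j)` entry),
  **`valuation_det_submatrix_le_of_mem_orbit_of_monotone`** (minors on `K ϖ^a K · P`, `a` monotone, bounded by
  `|ϖ|^{∑_{i<r} a_i}`).
* §2 Bruhat–Tits (4.4.4) for monotone exponents: **`sum_ite_lt_le_sum_ite_lt_iwasawaExp_of_mem_orbit`** ((i) in the
  antidominant normalisation: `∑_{i<r} a_i ≤ ∑_{i<r} e(g)_i` for `gK ⊆ K ϖ^a K`), **`coe_eq_zpowDiagGL_of_mem_orbit_of_iwasawaExp_eq`**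
  — (4.4.4) (ii) FOR `GL_n`: `gK ⊆ K ϖ^a K` and `e(g) = a` force `gK = ϖ^a K` —, its antitone-indexed form
  `coe_eq_zpowDiagGL_rev_of_mem_orbit_of_antitone`, and the counting forms `filter_iwasawaExp_orbit_zpowDiagGL_eq_singleton`,
  **`card_filter_iwasawaExp_orbit_zpowDiagGL_eq_one`** (`#{γ ⊆ K ϖ^a K : e(γ) = a} = 1`).
* §3 (abstract, any Iwasawa datum `h : IsIwasawaExponent P K a`, ANY commutative ring `R`) the injectivity criterion with
  the extra hypothesis (UNIQUENESS) «for `t ∈ D`, the only coset `γ ⊆ KtK` with `a(γ) = a(t)` is `tK`»: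
  `filter_support_eq_singleton_of_isMax`, `coeff_satakeVec_of_isMax_of_unique`, **`eq_zero_of_satakeVec_eq_zero_of_unique`**,
  **`satakeTransform_injective_of_unique`**, **`coeff_self_satakeTransform_doubleCosetOperator_of_unique`** (leading
  coefficient `= w(a(t))`, a unit).
* §4 the `GL_n` datum with the MONOTONE Cartan representatives `D = {ϖ^a : a monotone}`: `exists_zpowDiagGL_monotone_mem_orbit`
  (CARTAN), `injOn_iwasawaExp_zpowDiagGL_monotone` (SEPARATION), `iwasawaExp_eq_or_headSum_gt` (DOMINANCE, head sums in the
  DUAL lexicographic order), `eq_coe_of_mem_orbit_zpowDiagGL_monotone` (UNIQUENESS), and the conclusions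
  **`satakeTransform_gl_injective_of_commRing`** — THE SATAKE TRANSFORM OF `ℋ(GL_n(F), GL_n(𝒪); R)` IS INJECTIVE FOR EVERY
  WEIGHT AND EVERY COMMUTATIVE COEFFICIENT RING `R` —, `coeff_satakeTransform_doubleCosetOperator_zpowDiagGL_monotone`
  (the coefficient of `x^a` in `𝒮_w(T_{ϖ^a})` is `w(a)`), `coeff_glSatakeTransform_doubleCosetOperator_zpowDiagGL_monotone`
  (the tree's `ℂ`-valued `satakeTransform hϖ`: the coefficient is `q^{-⟨ν, a⟩}`).

## References
* [BruhatTits1972] F. Bruhat, J. Tits, *Groupes réductifs sur un corps local. I*, Publ. Math. IHÉS 41 (1972), Prop. (4.4.4)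
  (i), (ii), p. 80.
* [Macdonald1995] I. G. Macdonald, *Symmetric Functions and Hall Polynomials*, 2nd ed. (1995), Ch. II §1, Ch. V (2.3),
  (2.6)–(2.7).
* [CartierCorvallis1979] P. Cartier, *Representations of 𝔭-adic groups: a survey*, PSPM 33.1 (1979), §IV (4.2), Thm. 4.1,
  proof (b)–(c).
-/

noncomputable section

open scoped MatrixGroups Pointwise
open ValuativeRel Matrix Finset MonoidAlgebra Representation MulAction

namespace Literature.NumberTheory.Automorphic

open Literature.NumberTheory.Automorphic.CartanUnique Literature.NumberTheory.Automorphic.HermitianLattice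

/-! ## §1 Minors: the leading corner of an upper triangular matrix, the `(0..i | 0..i-1, j)` minor of a unitriangular one,
and the bound on `K ϖ^a K · P` for monotone `a` -/

section Minors

variable {F : Type*} [Field F] {n : ℕ}

/-- **The upper-left `r × r` corner minor of an upper triangular matrix is the product of its first `r` diagonal entries.**
[cite: Macdonald1995, Ch. II §1] [cite: BruhatTits1972, Prop. (4.4.4)] -/
theorem det_submatrix_first_of_blockTriangular {b : Matrix (Fin n) (Fin n) F} (hb : b.BlockTriangular id) {r : ℕ}
    (hr : r ≤ n) :
    (b.submatrix (fun j : Fin r => (⟨j, by omega⟩ : Fin n)) (fun j : Fin r => (⟨j, by omega⟩ : Fin n))).det =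
      ∏ j : Fin r, b ⟨j, by omega⟩ ⟨j, by omega⟩ := by
  have hf : StrictMono (fun j : Fin r => (⟨j, by omega⟩ : Fin n)) := fun i j hij => by
    rw [Fin.lt_def] at hij ⊢
    exact hij
  rw [Matrix.det_of_upperTriangular (blockTriangular_submatrix_of_strictMono hb hf)]
  rfl

/-- The first `r` values, summed through the embedding `j ↦ j`, give the head sum `∑_{i<r} f_i`.
[cite: BruhatTits1972, Prop. (4.4.4)] -/
theorem sum_first_eq_sum_ite {r : ℕ} (hr : r ≤ n) (f : Fin n → ℤ) :
    ∑ j : Fin r, f ⟨j, by omega⟩ = ∑ i : Fin n, if (i : ℕ) < r then f i else 0 := by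
  classical
  rw [← Finset.sum_filter]
  have hT : univ.filter (fun i : Fin n => (i : ℕ) < r) = univ.image (fun j : Fin r => (⟨j, by omega⟩ : Fin n)) := by
    ext i
    simp only [Finset.mem_filter, Finset.mem_univ, true_and, Finset.mem_image]
    constructor
    · intro hi
      exact ⟨⟨i, hi⟩, Fin.ext rfl⟩
    · rintro ⟨j, rfl⟩
      exact j.isLt
  rw [hT, Finset.sum_image]
  intro j _ j' _ h
  simp only [Fin.mk.injEq] at h
  exact Fin.ext h

/-- Reversal turns tail sums into head sums: `∑_{i ≥ n-r} a_{rev i} = ∑_{i<r} a_i`. [cite: BruhatTits1972, Prop. (4.4.4)] -/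
theorem sum_ite_le_comp_rev_eq_sum_ite_lt (a : Fin n → ℤ) (r : ℕ) :
    (∑ i : Fin n, if n ≤ (i : ℕ) + r then a (Fin.rev i) else 0) = ∑ i : Fin n, if (i : ℕ) < r then a i else 0 := by
  rw [← Equiv.sum_comp Fin.revPerm (fun i : Fin n => if (i : ℕ) < r then a i else 0)]
  refine Finset.sum_congr rfl fun i _ => ?_
  rw [Fin.revPerm_apply, Fin.val_rev]
  have hi := i.isLt
  by_cases h : n ≤ (i : ℕ) + r
  · rw [if_pos h, if_pos (by omega)]
  · rw [if_neg h, if_neg (by omega)]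

/-- **The `(i+1) × (i+1)` minor of an upper unitriangular matrix `v` with rows `0, …, i` and columns `0, …, i-1, j`, `i < j`,
is the entry `v_{ij}`**: the submatrix is upper triangular with diagonal `(1, …, 1, v_{ij})`.
[cite: Macdonald1995, Ch. II §1] [cite: BruhatTits1972, Prop. (4.4.4) (ii)] -/
theorem det_submatrix_castSucc_of_upperUnitriangular {v : GL (Fin n) F} (hv : v ∈ upperUnitriangular (Fin n) F)
    {i j : Fin n} (hij : i < j) :
    ((v : Matrix (Fin n) (Fin n) F).submatrix (fun l : Fin ((i : ℕ) + 1) => (⟨l, by omega⟩ : Fin n))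
        (fun l : Fin ((i : ℕ) + 1) => if (l : ℕ) < (i : ℕ) then (⟨l, by omega⟩ : Fin n) else j)).det =
      (v : Matrix (Fin n) (Fin n) F) i j := by
  obtain ⟨hvT, hvD⟩ := (mem_upperUnitriangular_iff v).1 hv
  have hij' : (i : ℕ) < (j : ℕ) := hij
  -- the submatrix is upper triangular
  have hT : ((v : Matrix (Fin n) (Fin n) F).submatrix (fun l : Fin ((i : ℕ) + 1) => (⟨l, by omega⟩ : Fin n))
      (fun l : Fin ((i : ℕ) + 1) => if (l : ℕ) < (i : ℕ) then (⟨l, by omega⟩ : Fin n) else j)).BlockTriangular id := by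
    intro l l' hll'
    have hll'' : (l' : ℕ) < (l : ℕ) := hll'
    have hl'i : (l' : ℕ) < (i : ℕ) := by have := l.isLt; omega
    rw [Matrix.submatrix_apply, if_pos hl'i]
    exact hvT (show ((⟨l', by omega⟩ : Fin n) : ℕ) < ((⟨l, by omega⟩ : Fin n) : ℕ) from hll'')
  rw [Matrix.det_of_upperTriangular hT, Fin.prod_univ_castSucc, Finset.prod_eq_one, one_mul]
  · simp only [Matrix.submatrix_apply, Fin.val_last, lt_self_iff_false, if_false]
  · intro l _
    have hl : ((Fin.castSucc l : Fin ((i : ℕ) + 1)) : ℕ) < (i : ℕ) := by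
      rw [Fin.val_castSucc]
      exact l.isLt
    simp only [Matrix.submatrix_apply, hl, if_true]
    exact hvD _

/-- The column selection `(0, …, i-1, j)` (`i < j`) is injective. [cite: BruhatTits1972, Prop. (4.4.4) (ii)] -/
theorem injective_castSucc_cols {i j : Fin n} (hij : i < j) :
    Function.Injective (fun l : Fin ((i : ℕ) + 1) => if (l : ℕ) < (i : ℕ) then (⟨l, by omega⟩ : Fin n) else j) := by
  have hij' : (i : ℕ) < (j : ℕ) := hij
  intro l l' h
  dsimp only at h
  have hl := l.isLt
  have hl' := l'.isLt
  by_cases h1 : (l : ℕ) < (i : ℕ) <;> by_cases h2 : (l' : ℕ) < (i : ℕ)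
  · rw [if_pos h1, if_pos h2, Fin.mk.injEq] at h
    exact Fin.ext h
  · rw [if_pos h1, if_neg h2] at h
    have := congrArg Fin.val h
    simp only at this
    omega
  · rw [if_neg h1, if_pos h2] at h
    have := congrArg Fin.val h
    simp only at this
    omega
  · exact Fin.ext (by omega)

variable [ValuativeRel F] {ϖ : F}

/-- **Minors on `K ϖ^a K · P` for MONOTONE `a`**: if `gK ⊆ K ϖ^a K` (`K = GL_n(𝒪)`, `a_1 ≤ ⋯ ≤ a_n`) and `P` is integral,
every `r × r` minor of `g P` with injective column selection has valuation `≤ |ϖ|^{∑_{i<r} a_i}` (the `r` smallest exponents;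
`K ϖ^a K = K ϖ^{a ∘ rev} K` with `a ∘ rev` antitone, and `valuation_det_submatrix_le_of_eq_mul_zpowDiagGL_mul`).
[cite: Macdonald1995, Ch. II §1, Ch. V (2.6)] [cite: BruhatTits1972, Prop. (4.4.4)] -/
theorem valuation_det_submatrix_le_of_mem_orbit_of_monotone (hϖ : IsUniformizingElement ϖ) {a : Fin n → ℤ} (ha : Monotone a)
    {g : GL (Fin n) F}
    (hg : (g : GL (Fin n) F ⧸ glInt n F) ∈ orbit (glInt n F) (zpowDiagGL hϖ.ne_zero a : GL (Fin n) F ⧸ glInt n F))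
    {P : Matrix (Fin n) (Fin n) F} (hP : IsIntegralMatrix P) {r : ℕ} (ρ c : Fin r → Fin n) (hc : Function.Injective c) :
    valuation F (((g : Matrix (Fin n) (Fin n) F) * P).submatrix ρ c).det ≤
      valuation F ϖ ^ (∑ i : Fin n, if (i : ℕ) < r then a i else 0) := by
  obtain ⟨A, hA, B, hB, hgAB⟩ := (heckeAlgebra.coe_mem_orbit_coe_iff (glInt n F) _ _).1 hg
  -- the antitone rearrangement `a' = a ∘ rev` and the permutation matrix conjugating `ϖ^{a'}` to `ϖ^a`
  have ha' : Antitone (a ∘ Fin.rev) := fun i j hij => ha (Fin.rev_le_rev.2 hij)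
  have hconj : (permGL Fin.revPerm : GL (Fin n) F) * zpowDiagGL hϖ.ne_zero (a ∘ Fin.rev) * (permGL Fin.revPerm)⁻¹ =
      zpowDiagGL hϖ.ne_zero a := by
    rw [permGL_mul_zpowDiagGL_mul_inv]
    congr 1
    funext i
    simp only [Function.comp_apply, Fin.revPerm_apply, Fin.rev_rev]
  have hG : g = (A * permGL Fin.revPerm) * zpowDiagGL hϖ.ne_zero (a ∘ Fin.rev) * ((permGL Fin.revPerm)⁻¹ * B) := by
    rw [hgAB, ← hconj]
    group
  have hmat : (g : Matrix (Fin n) (Fin n) F) * P =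
      ((A * permGL Fin.revPerm : GL (Fin n) F) : Matrix (Fin n) (Fin n) F) *
        (zpowDiagGL hϖ.ne_zero (a ∘ Fin.rev) : GL (Fin n) F) * ((permGL Fin.revPerm)⁻¹ * B : GL (Fin n) F) * P := by
    rw [hG, Units.val_mul, Units.val_mul]
  have h1 := valuation_det_submatrix_le_of_eq_mul_zpowDiagGL_mul hϖ.ne_zero hϖ.valuation_le_one ha'
    ((glInt n F).mul_mem hA (permGL_mem_glInt _)) ((glInt n F).mul_mem ((glInt n F).inv_mem (permGL_mem_glInt _)) hB)
    hP hmat ρ c hc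
  have h2 : (∑ i : Fin n, if n ≤ (i : ℕ) + r then (a ∘ Fin.rev) i else 0) = ∑ i : Fin n, if (i : ℕ) < r then a i else 0 :=
    sum_ite_le_comp_rev_eq_sum_ite_lt a r
  rwa [h2] at h1

end Minors

/-! ## §2 Bruhat–Tits (4.4.4) for `GL_n` in the antidominant (monotone) normalisation: head sums and uniqueness -/

section BruhatTits

variable {F : Type*} [Field F] [ValuativeRel F] {n : ℕ} [IsDiscreteValuationRing 𝒪[F]] {ϖ : F}

/-- **Head sums, monotone form of (4.4.4) (i)**: if `gK ⊆ K ϖ^a K` (`K = GL_n(𝒪)`, `a ∈ ℤⁿ` monotone) then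
`∑_{i<r} a_i ≤ ∑_{i<r} e(g)_i` for every `r`, `e(g) = iwasawaExp` (compare the upper-left `r × r` corner minor
`ϖ^{∑_{i<r} e_i}` of the upper triangular `u ϖ^{e} = g k⁻¹` with the bound on all `r × r` minors of `K ϖ^a K · K`).
[cite: BruhatTits1972, Prop. (4.4.4) (i)] [cite: Macdonald1995, Ch. V (2.6)] -/
theorem sum_ite_lt_le_sum_ite_lt_iwasawaExp_of_mem_orbit (hϖ : IsUniformizingElement ϖ) {a : Fin n → ℤ} (ha : Monotone a)
    {g : GL (Fin n) F}
    (hg : (g : GL (Fin n) F ⧸ glInt n F) ∈ orbit (glInt n F) (zpowDiagGL hϖ.ne_zero a : GL (Fin n) F ⧸ glInt n F))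
    (r : ℕ) :
    (∑ i : Fin n, if (i : ℕ) < r then a i else 0) ≤ ∑ i : Fin n, if (i : ℕ) < r then iwasawaExp hϖ g i else 0 := by
  wlog hr : r ≤ n generalizing r
  · have h := this n le_rfl
    have h1 : ∀ f : Fin n → ℤ, (∑ i : Fin n, if (i : ℕ) < r then f i else 0) = ∑ i : Fin n, if (i : ℕ) < n then f i else 0 :=
      fun f => Finset.sum_congr rfl fun i _ => by rw [if_pos (by omega), if_pos i.isLt]
    rw [h1, h1]
    exact h
  have hv0 : valuation F ϖ ≠ 0 := (Valuation.ne_zero_iff _).2 hϖ.ne_zero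
  obtain ⟨u, hu, k, hk, hutk⟩ := iwasawaExp_spec hϖ g
  set e := iwasawaExp hϖ g with he
  have hbT : ((u * zpowDiagGL hϖ.ne_zero e : GL (Fin n) F) : Matrix (Fin n) (Fin n) F).BlockTriangular id :=
    blockTriangular_mul_zpowDiagGL hu hϖ.ne_zero e
  have hmat : (g : Matrix (Fin n) (Fin n) F) * ((k⁻¹ : GL (Fin n) F) : Matrix (Fin n) (Fin n) F) =
      ((u * zpowDiagGL hϖ.ne_zero e : GL (Fin n) F) : Matrix (Fin n) (Fin n) F) := by
    rw [← Units.val_mul, hutk, mul_inv_cancel_right]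
  have h1 := valuation_det_submatrix_le_of_mem_orbit_of_monotone hϖ ha hg (isIntegralMatrix_inv_of_mem_glInt hk)
    (fun j : Fin r => (⟨j, by omega⟩ : Fin n)) (fun j : Fin r => (⟨j, by omega⟩ : Fin n))
    (fun j j' hjj' => by simp only [Fin.mk.injEq] at hjj'; exact Fin.ext hjj')
  rw [hmat, det_submatrix_first_of_blockTriangular hbT hr] at h1
  simp_rw [mul_zpowDiagGL_apply_self hu hϖ.ne_zero e] at h1
  rw [map_prod] at h1
  simp_rw [map_zpow₀] at h1
  rw [prod_valuation_zpow_eq _ hv0, sum_first_eq_sum_ite hr] at h1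
  exact (zpow_le_zpow_iff_right_of_lt_one₀ (zero_lt_iff.2 hv0) hϖ.valuation_lt_one).1 h1

omit [ValuativeRel F] [IsDiscreteValuationRing 𝒪[F]] in
/-- The entries of the conjugate `ϖ^{-a} u ϖ^{a}`: `(ϖ^{-a} u ϖ^{a})_{ij} = ϖ^{a_j - a_i} u_{ij}`.
[cite: BruhatTits1972, Prop. (4.4.4) (ii)] -/
theorem coe_zpowDiagGL_inv_mul_mul_zpowDiagGL_apply (hϖ0 : ϖ ≠ 0) (a : Fin n → ℤ) (u : GL (Fin n) F) (i j : Fin n) :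
    (((zpowDiagGL hϖ0 a)⁻¹ * u * zpowDiagGL hϖ0 a : GL (Fin n) F) : Matrix (Fin n) (Fin n) F) i j =
      ϖ ^ (a j - a i) * (u : Matrix (Fin n) (Fin n) F) i j := by
  rw [← zpowDiagGL_neg, Units.val_mul, Units.val_mul, coe_zpowDiagGL, coe_zpowDiagGL, Matrix.mul_diagonal,
    Matrix.diagonal_mul, Pi.neg_apply, zpow_sub₀ hϖ0, _root_.zpow_neg]
  ring

/-- **BRUHAT–TITS (4.4.4) (ii) FOR `GL_n`** («On a `K.t.K ∩ B̂⁰.t.K = t.K`»): if the coset `gK` lies in `K ϖ^a K`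
(`K = GL_n(𝒪)`, `a ∈ ℤⁿ` MONOTONE) and its Iwasawa exponent is `e(g) = a` (`g ∈ N ϖ^a K`), then `gK = ϖ^a K`.  Proof by
minors: `g = u ϖ^a k`, `v = ϖ^{-a} u ϖ^a` is upper unitriangular with `ϖ^a v = g k⁻¹`, and the `(i+1) × (i+1)` minor of
`ϖ^a v` with rows `0..i`, columns `0..i-1, j` is `ϖ^{a_0 + ⋯ + a_i} v_{ij}`, of valuation `≤ |ϖ|^{a_0 + ⋯ + a_i}`; so `v ∈ K`.
[cite: BruhatTits1972, Prop. (4.4.4) (ii)] [cite: Macdonald1995, Ch. V (2.6)–(2.7)] -/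
theorem coe_eq_zpowDiagGL_of_mem_orbit_of_iwasawaExp_eq (hϖ : IsUniformizingElement ϖ) {a : Fin n → ℤ} (ha : Monotone a)
    {g : GL (Fin n) F}
    (hg : (g : GL (Fin n) F ⧸ glInt n F) ∈ orbit (glInt n F) (zpowDiagGL hϖ.ne_zero a : GL (Fin n) F ⧸ glInt n F))
    (he : iwasawaExp hϖ g = a) :
    (g : GL (Fin n) F ⧸ glInt n F) = (zpowDiagGL hϖ.ne_zero a : GL (Fin n) F ⧸ glInt n F) := by
  have hv0 : valuation F ϖ ≠ 0 := (Valuation.ne_zero_iff _).2 hϖ.ne_zero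
  obtain ⟨u, hu, k, hk, hutk⟩ := iwasawaExp_spec hϖ g
  rw [he] at hutk
  obtain ⟨huT, huD⟩ := (mem_upperUnitriangular_iff u).1 hu
  -- `v = ϖ^{-a} u ϖ^{a}` is upper unitriangular
  set v : GL (Fin n) F := (zpowDiagGL hϖ.ne_zero a)⁻¹ * u * zpowDiagGL hϖ.ne_zero a with hv_def
  have hvU : v ∈ upperUnitriangular (Fin n) F := by
    have := zpowDiagGL_mul_mul_inv_mem_upperUnitriangular hϖ.ne_zero (-a) hu
    rwa [zpowDiagGL_neg, inv_inv] at this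
  obtain ⟨hvT, hvD⟩ := (mem_upperUnitriangular_iff v).1 hvU
  -- `ϖ^a v = u ϖ^a = g k⁻¹`
  have hmatv : (g : Matrix (Fin n) (Fin n) F) * ((k⁻¹ : GL (Fin n) F) : Matrix (Fin n) (Fin n) F) =
      ((zpowDiagGL hϖ.ne_zero a : GL (Fin n) F) : Matrix (Fin n) (Fin n) F) * (v : Matrix (Fin n) (Fin n) F) := by
    rw [← Units.val_mul, ← Units.val_mul, hutk, mul_inv_cancel_right, hv_def, ← mul_assoc, ← mul_assoc, mul_inv_cancel, one_mul]
  -- `v ∈ K`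
  have hvK : v ∈ glInt n F := by
    refine mem_glInt_of_isIntegralMatrix (fun i j => ?_) ?_
    · rcases lt_trichotomy i j with hij | rfl | hji
      · -- the minor argument
        have hij' : (i : ℕ) < (j : ℕ) := hij
        have hi1 : (i : ℕ) + 1 ≤ n := by have := j.isLt; omega
        have h1 := valuation_det_submatrix_le_of_mem_orbit_of_monotone hϖ ha hg (isIntegralMatrix_inv_of_mem_glInt hk)
          (fun l : Fin ((i : ℕ) + 1) => (⟨l, by omega⟩ : Fin n))
          (fun l : Fin ((i : ℕ) + 1) => if (l : ℕ) < (i : ℕ) then (⟨l, by omega⟩ : Fin n) else j) (injective_castSucc_cols hij)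
        rw [hmatv, coe_zpowDiagGL] at h1
        have hsub : ((Matrix.diagonal fun i : Fin n => ϖ ^ a i) * (v : Matrix (Fin n) (Fin n) F)).submatrix
            (fun l : Fin ((i : ℕ) + 1) => (⟨l, by omega⟩ : Fin n))
            (fun l : Fin ((i : ℕ) + 1) => if (l : ℕ) < (i : ℕ) then (⟨l, by omega⟩ : Fin n) else j) =
            Matrix.diagonal (fun l : Fin ((i : ℕ) + 1) => ϖ ^ a ⟨l, by omega⟩) *
              (v : Matrix (Fin n) (Fin n) F).submatrix (fun l : Fin ((i : ℕ) + 1) => (⟨l, by omega⟩ : Fin n))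
                (fun l : Fin ((i : ℕ) + 1) => if (l : ℕ) < (i : ℕ) then (⟨l, by omega⟩ : Fin n) else j) := by
          ext l m
          rw [Matrix.submatrix_apply, Matrix.diagonal_mul, Matrix.diagonal_mul, Matrix.submatrix_apply]
        rw [hsub, Matrix.det_mul, Matrix.det_diagonal, det_submatrix_castSucc_of_upperUnitriangular hvU hij, map_mul,
          map_prod] at h1
        simp_rw [map_zpow₀] at h1
        rw [prod_valuation_zpow_eq _ hv0, sum_first_eq_sum_ite hi1] at h1
        -- cancel the power of `|ϖ|`
        have hc : valuation F ϖ ^ (∑ i' : Fin n, if (i' : ℕ) < (i : ℕ) + 1 then a i' else 0) ≠ 0 := zpow_ne_zero _ hv0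
        have h3 := mul_le_mul_right h1 (valuation F ϖ ^ (∑ i' : Fin n, if (i' : ℕ) < (i : ℕ) + 1 then a i' else 0))⁻¹
        rw [inv_mul_cancel_left₀ hc, inv_mul_cancel₀ hc] at h3
        exact (Valuation.mem_integer_iff _ _).2 h3
      · rw [hvD i]
        exact Subring.one_mem _
      · rw [hvT (show (id j) < (id i) from hji)]
        exact Subring.zero_mem _
    · rw [Matrix.det_of_upperTriangular hvT, Finset.prod_eq_one fun i _ => hvD i, map_one]
  -- conclude: `g⁻¹ ϖ^a = k⁻¹ v⁻¹ ∈ K`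
  rw [QuotientGroup.eq, hutk]
  have hcalc : (u * zpowDiagGL hϖ.ne_zero a * k)⁻¹ * zpowDiagGL hϖ.ne_zero a = k⁻¹ * v⁻¹ := by
    rw [hv_def]
    group
  rw [hcalc]
  exact (glInt n F).mul_mem ((glInt n F).inv_mem hk) ((glInt n F).inv_mem hvK)

/-- (4.4.4) (ii) on cosets: for `a` monotone, a coset `γ ⊆ K ϖ^a K` with `e(γ) = a` IS `ϖ^a K`.
[cite: BruhatTits1972, Prop. (4.4.4) (ii)] -/
theorem eq_coe_zpowDiagGL_of_mem_orbit_of_iwasawaExp_out_eq (hϖ : IsUniformizingElement ϖ) {a : Fin n → ℤ}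
    (ha : Monotone a) {γ : GL (Fin n) F ⧸ glInt n F}
    (hγ : γ ∈ orbit (glInt n F) (zpowDiagGL hϖ.ne_zero a : GL (Fin n) F ⧸ glInt n F)) (he : iwasawaExp hϖ γ.out = a) :
    γ = (zpowDiagGL hϖ.ne_zero a : GL (Fin n) F ⧸ glInt n F) := by
  have hγ' : (γ.out : GL (Fin n) F ⧸ glInt n F) ∈ orbit (glInt n F) (zpowDiagGL hϖ.ne_zero a : GL (Fin n) F ⧸ glInt n F) := by
    rwa [QuotientGroup.out_eq']
  rw [← QuotientGroup.out_eq' γ]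
  exact coe_eq_zpowDiagGL_of_mem_orbit_of_iwasawaExp_eq hϖ ha hγ' he

/-- **Antitone-indexed form** (Macdonald's `λ_1 ≥ ⋯ ≥ λ_n`): the only coset of `K ϖ^λ K` whose Iwasawa exponent is the
reversed vector `λ ∘ rev = (λ_n, …, λ_1)` is `ϖ^{λ ∘ rev} K`. [cite: BruhatTits1972, Prop. (4.4.4) (ii)]
[cite: Macdonald1995, Ch. V (2.6)–(2.7)] -/
theorem eq_coe_zpowDiagGL_rev_of_mem_orbit_of_antitone (hϖ : IsUniformizingElement ϖ) {a : Fin n → ℤ} (ha : Antitone a)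
    {γ : GL (Fin n) F ⧸ glInt n F}
    (hγ : γ ∈ orbit (glInt n F) (zpowDiagGL hϖ.ne_zero a : GL (Fin n) F ⧸ glInt n F))
    (he : iwasawaExp hϖ γ.out = a ∘ Fin.rev) :
    γ = (zpowDiagGL hϖ.ne_zero (a ∘ Fin.rev) : GL (Fin n) F ⧸ glInt n F) := by
  have ha' : Monotone (a ∘ Fin.rev) := fun i j hij => ha (Fin.rev_le_rev.2 hij)
  -- `K ϖ^a K = K ϖ^{a ∘ rev} K`
  obtain ⟨k₁, hk₁, k₂, hk₂, hk⟩ := exists_glInt_mul_zpowDiagGL_mul_eq_of_perm hϖ.ne_zero (a := a) (b := a ∘ Fin.rev)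
    Fin.revPerm (fun i => by simp only [Function.comp_apply, Fin.revPerm_apply, Fin.rev_rev])
  have hmem : (zpowDiagGL hϖ.ne_zero (a ∘ Fin.rev) : GL (Fin n) F ⧸ glInt n F) ∈
      orbit (glInt n F) (zpowDiagGL hϖ.ne_zero a : GL (Fin n) F ⧸ glInt n F) :=
    (heckeAlgebra.coe_mem_orbit_coe_iff (glInt n F) _ _).2 ⟨k₁, hk₁, k₂, hk₂, hk.symm⟩
  rw [← MulAction.orbit_eq_iff.2 hmem] at hγ
  exact eq_coe_zpowDiagGL_of_mem_orbit_of_iwasawaExp_out_eq hϖ ha' hγ he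

/-- The set form of (4.4.4) (ii): `{γ ⊆ K ϖ^a K : e(γ) = a} = {ϖ^a K}` for `a` monotone.
[cite: BruhatTits1972, Prop. (4.4.4) (ii)] -/
theorem sep_orbit_zpowDiagGL_iwasawaExp_eq_singleton (hϖ : IsUniformizingElement ϖ) {a : Fin n → ℤ} (ha : Monotone a) :
    {γ ∈ orbit (glInt n F) (zpowDiagGL hϖ.ne_zero a : GL (Fin n) F ⧸ glInt n F) | iwasawaExp hϖ γ.out = a} =
      {(zpowDiagGL hϖ.ne_zero a : GL (Fin n) F ⧸ glInt n F)} := by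
  ext γ
  simp only [Set.mem_setOf_eq, Set.mem_singleton_iff]
  constructor
  · rintro ⟨hγ, he⟩
    exact eq_coe_zpowDiagGL_of_mem_orbit_of_iwasawaExp_out_eq hϖ ha hγ he
  · rintro rfl
    exact ⟨mem_orbit_self _, (iwasawaExp_out_coe hϖ _).trans (iwasawaExp_zpowDiagGL_gl hϖ a)⟩

variable [IsHeckeTriple (⊤ : Submonoid (GL (Fin n) F)) (glInt n F) (glInt n F)]

/-- The finset form of (4.4.4) (ii) (for `(GL_n(F), GL_n(𝒪))` a Hecke pair, e.g. finite residue field): among the finitely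
many cosets of `K ϖ^a K`, `a` monotone, exactly `ϖ^a K` has Iwasawa exponent `a`. [cite: BruhatTits1972, Prop. (4.4.4) (ii)] -/
theorem filter_iwasawaExp_orbit_zpowDiagGL_eq_singleton (hϖ : IsUniformizingElement ϖ) {a : Fin n → ℤ} (ha : Monotone a)
    [DecidablePred fun γ : GL (Fin n) F ⧸ glInt n F => iwasawaExp hϖ γ.out = a] :
    ((finite_orbit_quotient (glInt n F) (zpowDiagGL hϖ.ne_zero a)).toFinset.filter
        fun γ => iwasawaExp hϖ γ.out = a) =
      {(zpowDiagGL hϖ.ne_zero a : GL (Fin n) F ⧸ glInt n F)} := by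
  ext γ
  rw [Finset.mem_filter, Set.Finite.mem_toFinset, Finset.mem_singleton]
  constructor
  · rintro ⟨hγ, he⟩
    exact eq_coe_zpowDiagGL_of_mem_orbit_of_iwasawaExp_out_eq hϖ ha hγ he
  · rintro rfl
    exact ⟨mem_orbit_self _, (iwasawaExp_out_coe hϖ _).trans (iwasawaExp_zpowDiagGL_gl hϖ a)⟩

/-- **`#{γ ⊆ K ϖ^a K : e(γ) = a} = 1`** for `a` monotone — the count that makes the leading coefficient of the Satake
transform of `T_{ϖ^a}` a unit. [cite: BruhatTits1972, Prop. (4.4.4) (ii)] [cite: CartierCorvallis1979, §IV, proof of Thm. 4.1 (c)] -/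
theorem card_filter_iwasawaExp_orbit_zpowDiagGL_eq_one (hϖ : IsUniformizingElement ϖ) {a : Fin n → ℤ} (ha : Monotone a)
    [DecidablePred fun γ : GL (Fin n) F ⧸ glInt n F => iwasawaExp hϖ γ.out = a] :
    ((finite_orbit_quotient (glInt n F) (zpowDiagGL hϖ.ne_zero a)).toFinset.filter
        fun γ => iwasawaExp hϖ γ.out = a).card = 1 := by
  rw [filter_iwasawaExp_orbit_zpowDiagGL_eq_singleton hϖ ha, Finset.card_singleton]

end BruhatTits

/-! ## §3 The abstract injectivity criterion with (UNIQUENESS): any commutative coefficient ring -/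

namespace IsIwasawaExponent

variable {G : Type*} [Group G] {Λ : Type*} [AddCommGroup Λ] {R : Type*} [CommRing R]
variable {P K : Subgroup G} {a : G → Λ} {L : Type*} [LinearOrder L]

/-- Under (CARTAN), (SEPARATION), (DOMINANCE) and (UNIQUENESS) «for `t ∈ D` the only coset `γ ⊆ KtK` with `a(γ) = a(t)` is
`tK`»: if `v ∈ R[G/K]` is `K`-invariant and `γ₀ ∈ supp v` maximises `φ ∘ a`, then `γ₀` is the ONLY element of `supp v`
with exponent `a(γ₀)`. [cite: BruhatTits1972, Prop. (4.4.4) (i), (ii)] [cite: CartierCorvallis1979, §IV, proof of Thm. 4.1 (b)–(c)] -/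
theorem filter_support_eq_singleton_of_isMax (h : IsIwasawaExponent P K a) {D : Set G} {φ : Λ → L}
    (hcartan : ∀ γ₀ : G ⧸ K, ∃ t ∈ D, (t : G ⧸ K) ∈ orbit K γ₀) (hsep : Set.InjOn a D)
    (hdom : ∀ t ∈ D, ∀ γ ∈ orbit K (t : G ⧸ K), a γ.out = a t ∨ φ (a γ.out) < φ (a t))
    (huniq : ∀ t ∈ D, ∀ γ ∈ orbit K (t : G ⧸ K), a γ.out = a t → γ = (t : G ⧸ K))
    {v : MonoidAlgebra R (G ⧸ K)} (hv : ∀ k ∈ K, ofMulAction R G (G ⧸ K) k v = v) {γ₀ : G ⧸ K} (hγ₀ : γ₀ ∈ v.coeff.support)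
    (hmax : ∀ γ ∈ v.coeff.support, φ (a γ.out) ≤ φ (a γ₀.out)) [DecidablePred fun γ : G ⧸ K => a γ.out = a γ₀.out] :
    (v.coeff.support.filter fun γ => a γ.out = a γ₀.out) = {γ₀} := by
  obtain ⟨t₀, ht₀D, ht₀, horb⟩ := h.mem_orbit_of_isMax hcartan hsep hdom hv hγ₀ hmax
  have hall : ∀ γ ∈ v.coeff.support, a γ.out = a γ₀.out → γ = (t₀ : G ⧸ K) := fun γ hγ he =>
    huniq t₀ ht₀D γ (horb γ hγ he) (he.trans ht₀.symm)
  have hγ₀t : γ₀ = (t₀ : G ⧸ K) := hall γ₀ hγ₀ rfl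
  ext γ
  rw [Finset.mem_filter, Finset.mem_singleton]
  constructor
  · rintro ⟨hγ, he⟩
    rw [hall γ hγ he, hγ₀t]
  · rintro rfl
    exact ⟨hγ₀, rfl⟩

/-- **The leading coefficient of `satakeVec v` under (UNIQUENESS)**: with `γ₀ ∈ supp v` maximising `φ ∘ a` and `μ = a(γ₀)`,
the coefficient of `x^μ` is `w(μ) · v(γ₀)`. [cite: CartierCorvallis1979, §IV, proof of Thm. 4.1 (b)–(c)]
[cite: BruhatTits1972, Prop. (4.4.4) (ii)] -/
theorem coeff_satakeVec_of_isMax_of_unique (h : IsIwasawaExponent P K a) (w : Multiplicative Λ →* R) {D : Set G}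
    {φ : Λ → L} (hcartan : ∀ γ₀ : G ⧸ K, ∃ t ∈ D, (t : G ⧸ K) ∈ orbit K γ₀) (hsep : Set.InjOn a D)
    (hdom : ∀ t ∈ D, ∀ γ ∈ orbit K (t : G ⧸ K), a γ.out = a t ∨ φ (a γ.out) < φ (a t))
    (huniq : ∀ t ∈ D, ∀ γ ∈ orbit K (t : G ⧸ K), a γ.out = a t → γ = (t : G ⧸ K))
    {v : MonoidAlgebra R (G ⧸ K)} (hv : ∀ k ∈ K, ofMulAction R G (G ⧸ K) k v = v) {γ₀ : G ⧸ K} (hγ₀ : γ₀ ∈ v.coeff.support)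
    (hmax : ∀ γ ∈ v.coeff.support, φ (a γ.out) ≤ φ (a γ₀.out)) :
    (satakeVec K a w v).coeff (a γ₀.out) = w (Multiplicative.ofAdd (a γ₀.out)) * v.coeff γ₀ := by
  classical
  rw [coeff_satakeVec, h.filter_support_eq_singleton_of_isMax hcartan hsep hdom huniq hv hγ₀ hmax, Finset.sum_singleton]

/-- **A non-zero `K`-invariant vector has a non-zero transform, over ANY commutative coefficient ring**, under (CARTAN),
(SEPARATION), (DOMINANCE), (UNIQUENESS): the leading coefficient is `w(μ) · v(γ₀)` with `w(μ)` a unit.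
[cite: CartierCorvallis1979, §IV, proof of Thm. 4.1 (b)–(c)] [cite: BruhatTits1972, Prop. (4.4.4) (i), (ii)] -/
theorem eq_zero_of_satakeVec_eq_zero_of_unique (h : IsIwasawaExponent P K a) (w : Multiplicative Λ →* R) {D : Set G}
    {φ : Λ → L} (hcartan : ∀ γ₀ : G ⧸ K, ∃ t ∈ D, (t : G ⧸ K) ∈ orbit K γ₀) (hsep : Set.InjOn a D)
    (hdom : ∀ t ∈ D, ∀ γ ∈ orbit K (t : G ⧸ K), a γ.out = a t ∨ φ (a γ.out) < φ (a t))
    (huniq : ∀ t ∈ D, ∀ γ ∈ orbit K (t : G ⧸ K), a γ.out = a t → γ = (t : G ⧸ K))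
    {v : MonoidAlgebra R (G ⧸ K)} (hv : ∀ k ∈ K, ofMulAction R G (G ⧸ K) k v = v) (h0 : satakeVec K a w v = 0) :
    v = 0 := by
  classical
  by_contra hne
  have hSne : v.coeff.support.Nonempty := by
    rw [Finsupp.support_nonempty_iff, Ne, MonoidAlgebra.coeff_eq_zero]
    exact hne
  obtain ⟨γ₀, hγ₀S, hmax⟩ := v.coeff.support.exists_max_image (fun γ => φ (a γ.out)) hSne
  have hcoef := h.coeff_satakeVec_of_isMax_of_unique w hcartan hsep hdom huniq hv hγ₀S hmax
  rw [h0, AddMonoidAlgebra.coeff_zero, Finsupp.zero_apply] at hcoef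
  exact Finsupp.mem_support_iff.1 hγ₀S ((isUnit_weight w _).mul_right_eq_zero.1 hcoef.symm)

/-- **INJECTIVITY OF THE SATAKE TRANSFORM OVER ANY COMMUTATIVE COEFFICIENT RING** from (CARTAN) + (SEPARATION) +
(DOMINANCE) + (UNIQUENESS), for every weight `w`. [cite: CartierCorvallis1979, §IV Thm. 4.1 (injectivity half)]
[cite: BruhatTits1972, Prop. (4.4.4) (i), (ii)] -/
theorem satakeTransform_injective_of_unique (h : IsIwasawaExponent P K a) (w : Multiplicative Λ →* R) {D : Set G}
    {φ : Λ → L} (hcartan : ∀ γ₀ : G ⧸ K, ∃ t ∈ D, (t : G ⧸ K) ∈ orbit K γ₀) (hsep : Set.InjOn a D)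
    (hdom : ∀ t ∈ D, ∀ γ ∈ orbit K (t : G ⧸ K), a γ.out = a t ∨ φ (a γ.out) < φ (a t))
    (huniq : ∀ t ∈ D, ∀ γ ∈ orbit K (t : G ⧸ K), a γ.out = a t → γ = (t : G ⧸ K)) :
    Function.Injective (h.satakeTransform w) := by
  refine (injective_iff_map_eq_zero _).2 fun T hT => ?_
  rw [satakeTransform_apply] at hT
  have hv := h.eq_zero_of_satakeVec_eq_zero_of_unique w hcartan hsep hdom huniq
    (fun k hk => heckeAlgebra.ofMulAction_toVector K T hk) hT
  exact heckeAlgebra.toVector_injective K (by rw [hv, map_zero])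

variable [IsHeckeTriple (⊤ : Submonoid G) K K]

/-- **The leading coefficient is the unit `w(a(t))`**: if `tK` is the only coset of `KtK` with exponent `a(t)`, the
coefficient of `x^{a(t)}` in `𝒮_w(T_t)` is `w(a(t))` («`c(λ, λ) = δ(λ)^{1/2}`»).
[cite: CartierCorvallis1979, §IV, proof of Thm. 4.1 (c)] [cite: BruhatTits1972, Prop. (4.4.4) (ii)] -/
theorem coeff_self_satakeTransform_doubleCosetOperator_of_unique (h : IsIwasawaExponent P K a)
    (w : Multiplicative Λ →* R) {t : G} (huniq : ∀ γ ∈ orbit K (t : G ⧸ K), a γ.out = a t → γ = (t : G ⧸ K)) :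
    (h.satakeTransform w (heckeAlgebra.doubleCosetOperator K t)).coeff (a t) = w (Multiplicative.ofAdd (a t)) := by
  classical
  rw [h.coeff_self_satakeTransform_doubleCosetOperator]
  have hS : ((finite_orbit_quotient K t).toFinset.filter fun γ => a γ.out = a t) = {(t : G ⧸ K)} := by
    ext γ
    rw [Finset.mem_filter, Set.Finite.mem_toFinset, Finset.mem_singleton]
    constructor
    · rintro ⟨hγ, he⟩
      exact huniq γ hγ he
    · rintro rfl
      exact ⟨mem_orbit_self _, h.apply_out_coe t⟩
  rw [hS, Finset.card_singleton, Nat.cast_one, one_mul]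

end IsIwasawaExponent

/-! ## §4 The `GL_n` datum with monotone Cartan representatives: injectivity over any commutative ring -/

section GLn

variable {F : Type*} [Field F] [ValuativeRel F] {n : ℕ} [IsDiscreteValuationRing 𝒪[F]] {ϖ : F}

/-- **(CARTAN), monotone representatives**: every coset `γ₀ ∈ GL_n(F)/GL_n(𝒪)` has some `ϖ^a GL_n(𝒪)`, `a` MONOTONE, in its
`GL_n(𝒪)`-orbit (the antitone representative of `SatakeTransformGLInjective` conjugated by the order-reversing permutation
matrix — Cartier's `G = K A⁻ K`). [cite: CartierCorvallis1979, §IV (4.2)] [cite: Macdonald1995, Ch. V (2.2)] -/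
theorem exists_zpowDiagGL_monotone_mem_orbit (hϖ : IsUniformizingElement ϖ) (γ₀ : GL (Fin n) F ⧸ glInt n F) :
    ∃ t ∈ {t : GL (Fin n) F | ∃ a : Fin n → ℤ, Monotone a ∧ t = zpowDiagGL hϖ.ne_zero a},
      (t : GL (Fin n) F ⧸ glInt n F) ∈ orbit (glInt n F) γ₀ := by
  obtain ⟨_, ⟨a, ha, rfl⟩, hmem⟩ := exists_zpowDiagGL_mem_orbit hϖ γ₀
  have ha' : Monotone (a ∘ Fin.rev) := fun i j hij => ha (Fin.rev_le_rev.2 hij)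
  refine ⟨_, ⟨a ∘ Fin.rev, ha', rfl⟩, ?_⟩
  obtain ⟨k₁, hk₁, k₂, hk₂, hk⟩ := exists_glInt_mul_zpowDiagGL_mul_eq_of_perm hϖ.ne_zero (a := a) (b := a ∘ Fin.rev)
    Fin.revPerm (fun i => by simp only [Function.comp_apply, Fin.revPerm_apply, Fin.rev_rev])
  have h1 : (zpowDiagGL hϖ.ne_zero (a ∘ Fin.rev) : GL (Fin n) F ⧸ glInt n F) ∈
      orbit (glInt n F) (zpowDiagGL hϖ.ne_zero a : GL (Fin n) F ⧸ glInt n F) :=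
    (heckeAlgebra.coe_mem_orbit_coe_iff (glInt n F) _ _).2 ⟨k₁, hk₁, k₂, hk₂, hk.symm⟩
  rwa [MulAction.orbit_eq_iff.2 hmem] at h1

/-- **(SEPARATION), monotone representatives**: `ϖ^a ↦ e(ϖ^a) = a` is injective on `{ϖ^a : a monotone}`.
[cite: CartierCorvallis1979, §IV (4.2)] -/
theorem injOn_iwasawaExp_zpowDiagGL_monotone (hϖ : IsUniformizingElement ϖ) :
    Set.InjOn (iwasawaExp hϖ) {t : GL (Fin n) F | ∃ a : Fin n → ℤ, Monotone a ∧ t = zpowDiagGL hϖ.ne_zero a} := by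
  rintro _ ⟨a, -, rfl⟩ _ ⟨a', -, rfl⟩ h
  rw [iwasawaExp_zpowDiagGL_gl, iwasawaExp_zpowDiagGL_gl] at h
  rw [h]

/-- **(DOMINANCE), monotone representatives**: for a coset `γ ⊆ K ϖ^a K` (`a` monotone) either `e(γ) = a` or the
head-sum vector of `e(γ)` is lexicographically LARGER than that of `a` — i.e. smaller in the dual order, so that `a` is the
strict maximum of `toDual ∘ toLex ∘ headSum` on the exponents of `K ϖ^a K`. [cite: BruhatTits1972, Prop. (4.4.4) (i)]
[cite: Macdonald1995, Ch. V (2.6)] -/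
theorem iwasawaExp_eq_or_headSum_gt (hϖ : IsUniformizingElement ϖ) :
    ∀ t ∈ {t : GL (Fin n) F | ∃ a : Fin n → ℤ, Monotone a ∧ t = zpowDiagGL hϖ.ne_zero a},
      ∀ γ ∈ orbit (glInt n F) (t : GL (Fin n) F ⧸ glInt n F),
        iwasawaExp hϖ γ.out = iwasawaExp hϖ t ∨
          OrderDual.toDual (toLex (fun r : Fin n => ∑ i : Fin n, if (i : ℕ) < (r : ℕ) + 1 then iwasawaExp hϖ γ.out i else 0)) <
            OrderDual.toDual (toLex (fun r : Fin n => ∑ i : Fin n, if (i : ℕ) < (r : ℕ) + 1 then iwasawaExp hϖ t i else 0)) := by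
  rintro _ ⟨a, ha, rfl⟩ γ hγ
  rw [iwasawaExp_zpowDiagGL_gl]
  have hγ' : (γ.out : GL (Fin n) F ⧸ glInt n F) ∈ orbit (glInt n F) (zpowDiagGL hϖ.ne_zero a : GL (Fin n) F ⧸ glInt n F) := by
    rwa [QuotientGroup.out_eq']
  have hle : ∀ r : ℕ, (∑ i : Fin n, if (i : ℕ) < r then a i else 0) ≤
      ∑ i : Fin n, if (i : ℕ) < r then iwasawaExp hϖ γ.out i else 0 :=
    fun r => sum_ite_lt_le_sum_ite_lt_iwasawaExp_of_mem_orbit hϖ ha hγ' r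
  rcases (toLex_headSum_le_of_forall_le hle).lt_or_eq with hlt | heq
  · exact Or.inr (OrderDual.toDual_lt_toDual.2 hlt)
  · exact Or.inl (eq_of_forall_le_of_toLex_le hle heq.symm.le).symm

/-- **(UNIQUENESS), monotone representatives** = Bruhat–Tits (4.4.4) (ii) for `GL_n` in the form used by the abstract
criterion. [cite: BruhatTits1972, Prop. (4.4.4) (ii)] -/
theorem eq_coe_of_mem_orbit_zpowDiagGL_monotone (hϖ : IsUniformizingElement ϖ) :
    ∀ t ∈ {t : GL (Fin n) F | ∃ a : Fin n → ℤ, Monotone a ∧ t = zpowDiagGL hϖ.ne_zero a},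
      ∀ γ ∈ orbit (glInt n F) (t : GL (Fin n) F ⧸ glInt n F),
        iwasawaExp hϖ γ.out = iwasawaExp hϖ t → γ = (t : GL (Fin n) F ⧸ glInt n F) := by
  rintro _ ⟨a, ha, rfl⟩ γ hγ he
  rw [iwasawaExp_zpowDiagGL_gl] at he
  exact eq_coe_zpowDiagGL_of_mem_orbit_of_iwasawaExp_out_eq hϖ ha hγ he

/-- **THE SATAKE TRANSFORM OF `ℋ(GL_n(F), GL_n(𝒪); R)` IS INJECTIVE FOR EVERY WEIGHT AND EVERY COMMUTATIVE COEFFICIENT RING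
`R`** (no domain or characteristic hypothesis; `F` any field with a `ValuativeRel` whose valuation ring is a DVR — no
completeness, no finiteness of the residue field): Cartier's linear-independence argument with the monotone Cartan
representatives, whose leading count is `1` by Bruhat–Tits (4.4.4) (ii).  The tree's
`isIwasawaExponent_gl_satakeTransform_injective` is the case `[IsDomain R] [CharZero R]`.
[cite: CartierCorvallis1979, §IV Thm. 4.1 (injectivity half)] [cite: BruhatTits1972, Prop. (4.4.4) (i), (ii)]
[cite: Macdonald1995, Ch. V (2.6)–(2.7)] -/
theorem satakeTransform_gl_injective_of_commRing {R : Type*} [CommRing R] (hϖ : IsUniformizingElement ϖ)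
    (w : Multiplicative (Fin n → ℤ) →* R) :
    Function.Injective ((isIwasawaExponent_gl hϖ).satakeTransform w) :=
  (isIwasawaExponent_gl hϖ).satakeTransform_injective_of_unique w
    (φ := fun μ : Fin n → ℤ =>
      OrderDual.toDual (toLex (fun r : Fin n => ∑ i : Fin n, if (i : ℕ) < (r : ℕ) + 1 then μ i else 0)))
    (exists_zpowDiagGL_monotone_mem_orbit hϖ) (injOn_iwasawaExp_zpowDiagGL_monotone hϖ) (iwasawaExp_eq_or_headSum_gt hϖ)
    (eq_coe_of_mem_orbit_zpowDiagGL_monotone hϖ)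

/-- Injectivity as a kernel statement: `𝒮_w(T) = 0 ⇒ T = 0` in `ℋ(GL_n(F), GL_n(𝒪); R)`, any commutative `R`.
[cite: CartierCorvallis1979, §IV Thm. 4.1 (injectivity half)] -/
theorem eq_zero_of_satakeTransform_gl_eq_zero {R : Type*} [CommRing R] (hϖ : IsUniformizingElement ϖ)
    (w : Multiplicative (Fin n → ℤ) →* R) {T : heckeAlgebra R (GL (Fin n) F) (glInt n F)}
    (hT : (isIwasawaExponent_gl hϖ).satakeTransform w T = 0) : T = 0 :=
  satakeTransform_gl_injective_of_commRing hϖ w (by rw [hT, map_zero])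

variable [IsHeckeTriple (⊤ : Submonoid (GL (Fin n) F)) (glInt n F) (glInt n F)]

/-- **The leading coefficient of `𝒮_w(T_{ϖ^a})` is the unit `w(a)`** (`a` monotone; any weight, any commutative ring):
the coefficient of `x^a` in the transform of the double-coset operator of `K ϖ^a K` is `w(a)` — «`c(λ, λ) = δ(λ)^{1/2}`».
[cite: CartierCorvallis1979, §IV, proof of Thm. 4.1 (c)] [cite: BruhatTits1972, Prop. (4.4.4) (ii)] -/
theorem coeff_satakeTransform_doubleCosetOperator_zpowDiagGL_monotone {R : Type*} [CommRing R]
    (hϖ : IsUniformizingElement ϖ) (w : Multiplicative (Fin n → ℤ) →* R) {a : Fin n → ℤ} (ha : Monotone a) :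
    ((isIwasawaExponent_gl hϖ).satakeTransform w
        (heckeAlgebra.doubleCosetOperator (glInt n F) (zpowDiagGL hϖ.ne_zero a))).coeff a =
      w (Multiplicative.ofAdd a) := by
  have h := (isIwasawaExponent_gl hϖ).coeff_self_satakeTransform_doubleCosetOperator_of_unique w
    (t := zpowDiagGL hϖ.ne_zero a)
    (fun γ hγ he => eq_coe_zpowDiagGL_of_mem_orbit_of_iwasawaExp_out_eq hϖ ha hγ (he.trans (iwasawaExp_zpowDiagGL_gl hϖ a)))
  rwa [iwasawaExp_zpowDiagGL_gl] at h

/-- The same for the tree's `ℂ`-valued transform `satakeTransform hϖ` (`SatakeTransformGL`, weight `q^{-⟨ν, ·⟩}`, `q = #𝓀`):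
the coefficient of `x^a` in `𝒮(T_{ϖ^a})`, `a` monotone, is `q^{-⟨ν, a⟩} = satakeWeight q a`.
[cite: CartierCorvallis1979, §IV (4.2), proof of Thm. 4.1 (c)] [cite: BruhatTits1972, Prop. (4.4.4) (ii)] -/
theorem coeff_glSatakeTransform_doubleCosetOperator_zpowDiagGL_monotone [Finite 𝓀[F]] (hϖ : IsUniformizingElement ϖ)
    {a : Fin n → ℤ} (ha : Monotone a) :
    (satakeTransform hϖ (heckeAlgebra.doubleCosetOperator (glInt n F) (zpowDiagGL hϖ.ne_zero a))).coeff a =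
      satakeWeight (Nat.card 𝓀[F] : ℂ) a := by
  rw [satakeTransform_eq_isIwasawaExponent_satakeTransform, coeff_satakeTransform_doubleCosetOperator_zpowDiagGL_monotone hϖ _ ha,
    satakeWeightHom_ofAdd]

end GLn

end Literature.NumberTheory.Automorphic

end
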